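import Mathlib
import HarnessLib

/-!
# The Multiplicative Weights algorithm: the regret bound of Arora–Hazan–Kale

HONEST FRAMING: instance-level adjudication of specific advantage claims; no claim about
BQP vs BPP or the summit.

The Multiplicative Weights (MW) algorithm of [cite: AroraHazanKale2012, §2, Figure 1]: `n`
decisions, rounds `t = 1, 2, …, T`; weights `w_i^{(1)} = 1` and, after the cost vector
`m^{(t)} ∈ [-1,1]^n` of round `t` is revealed, `w_i^{(t+1)} = w_i^{(t)} (1 - η m_i^{(t)})`
(eq. (2.1)); in round `t` the algorithm plays the distribution `p^{(t)} = w^{(t)} / Φ^{(t)}`,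
`Φ^{(t)} = Σ_i w_i^{(t)}`, and pays the expected cost `m^{(t)} · p^{(t)}`.

> **Theorem 2.1.** Assume that all costs `m_i^{(t)} ∈ [-1, 1]` and `η ≤ 1/2`. Then the
> Multiplicative Weights algorithm guarantees that after `T` rounds, for any decision `i`, we have
> `Σ_{t=1}^T m^{(t)} · p^{(t)} ≤ Σ_{t=1}^T m_i^{(t)} + η Σ_{t=1}^T |m_i^{(t)}| + (ln n) / η.`
> [cite: AroraHazanKale2012, Theorem 2.1]

> **Corollary 2.2.** The Multiplicative Weights algorithm also guarantees that after `T` rounds, for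
> any distribution `p` on the decisions,
> `Σ_{t=1}^T m^{(t)} · p^{(t)} ≤ Σ_{t=1}^T (m^{(t)} + η |m^{(t)}|) · p + (ln n) / η`,
> where `|m^{(t)}|` is the vector obtained by taking the coordinate-wise absolute value of
> `m^{(t)}`.
> [cite: AroraHazanKale2012, Corollary 2.2]

This is the meta-algorithm behind the classical (Arora–Kale) and quantum SDP / LP / zero-sum-game
solvers whose speed-up claims the cell adjudicates; the file records the printed statement and
follows the printed proof [cite: AroraHazanKale2012, §2, proof of Theorem 2.1, eqs. (2.1)–(2.5)]
line by line:

* `potential_succ`, `potential_succ_le` — `Φ^{(t+1)} = Φ^{(t)} (1 - η m^{(t)}·p^{(t)})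
  ≤ Φ^{(t)} exp(-η m^{(t)}·p^{(t)})`;
* `potential_le` — eq. (2.2), `Φ^{(T+1)} ≤ n · exp(-η Σ_t m^{(t)}·p^{(t)})`;
* `rpow_posPart_mul_rpow_negPart_le` — eq. (2.3), Bernoulli's inequalities
  `(1-η)^x ≤ 1 - ηx` (`x ∈ [0,1]`) and `(1+η)^{-x} ≤ 1 - ηx` (`x ∈ [-1,0]`), packaged as
  `(1-η)^{x⁺} (1+η)^{x⁻} ≤ 1 - ηx` for `|x| ≤ 1` (from Mathlib's
  `rpow_one_add_le_one_add_mul_self`);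
* `rpow_le_weight` — eq. (2.4), `Φ^{(T+1)} ≥ w_i^{(T+1)} ≥ (1-η)^{Σ_{≥0} m_i} (1+η)^{-Σ_{<0} m_i}`
  (written with positive and negative parts: `Σ_{≥0} m_i^{(t)} = Σ_t (m_i^{(t)})⁺`,
  `-Σ_{<0} m_i^{(t)} = Σ_t (m_i^{(t)})⁻`);
* `neg_log_one_sub_le`, `sub_sq_le_log_one_add` — eq. (2.5), `ln(1/(1-η)) ≤ η + η²` and
  `ln(1+η) ≥ η - η²` for `0 ≤ η ≤ 1/2`;
* **`regret_le`** — Theorem 2.1; **`regret_le_of_distribution`** — Corollary 2.2.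

Conventions: decisions are the elements of a nonempty finite type `ι` (`n = Fintype.card ι`);
rounds are indexed from `0`, so "after `T` rounds" is `t ∈ Finset.range T` and `weight η m T` is
the paper's `w^{(T+1)}`; `η` is taken positive (the bound divides by `η`; the paper's
"fix an `η ≤ 1/2`").

What is NOT here: the Hedge variant (Theorem 2.3), the gains form (Theorem 2.5), the restricted-
distribution form (Theorem 2.4), the lower bound of §4, and every application of §3.  No named
facts, no `sorry`.
-/

namespace Literature.Computability.Learning

open Finset Real

namespace MultiplicativeWeights

variable {ι : Type*} [Fintype ι]

/-! ## The algorithm [cite: AroraHazanKale2012, §2, Figure 1] -/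

section Algorithm

variable (η : ℝ) (m : ℕ → ι → ℝ)

/-- The MW weights: `w_i^{(1)} = 1` and `w_i^{(t+1)} = w_i^{(t)} (1 - η m_i^{(t)})` (rounds indexed
from `0`: `weight η m t` is the weight vector in force during round `t`).
[cite: AroraHazanKale2012, Figure 1 and eq. (2.1)] -/
def weight : ℕ → ι → ℝ
  | 0 => fun _ => 1
  | t + 1 => fun i => weight t i * (1 - η * m t i)

/-- The potential `Φ^{(t)} = Σ_i w_i^{(t)}`. [cite: AroraHazanKale2012, Figure 1 (step 1)] -/
def potential (t : ℕ) : ℝ := ∑ i, weight η m t i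

/-- The distribution played in round `t`: `p_i^{(t)} = w_i^{(t)} / Φ^{(t)}`.
[cite: AroraHazanKale2012, Figure 1 (step 1)] -/
noncomputable def prob (t : ℕ) (i : ι) : ℝ := weight η m t i / potential η m t

/-- The expected cost of round `t`: `m^{(t)} · p^{(t)} = Σ_i m_i^{(t)} p_i^{(t)}`.
[cite: AroraHazanKale2012, §2 ("The expected cost to the algorithm …")] -/
noncomputable def expCost (t : ℕ) : ℝ := ∑ i, m t i * prob η m t i

omit [Fintype ι] in
/-- `w_i^{(1)} = 1`. [cite: AroraHazanKale2012, Figure 1 (initialization)] -/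
@[simp] theorem weight_zero (i : ι) : weight η m 0 i = 1 := rfl

omit [Fintype ι] in
/-- The update rule `w_i^{(t+1)} = w_i^{(t)} (1 - η m_i^{(t)})`.
[cite: AroraHazanKale2012, eq. (2.1)] -/
theorem weight_succ (t : ℕ) (i : ι) : weight η m (t + 1) i = weight η m t i * (1 - η * m t i) := rfl

/-- `Φ^{(1)} = n`. [cite: AroraHazanKale2012, proof of Theorem 2.1 (eq. (2.2), `Φ^{(1)} = n`)] -/
theorem potential_zero : potential η m 0 = Fintype.card ι := by
  simp [potential]

end Algorithm

/-! ## The analysis [cite: AroraHazanKale2012, proof of Theorem 2.1] -/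

section Analysis

variable {η : ℝ} {m : ℕ → ι → ℝ}

/-- With `|x| ≤ 1` and `0 ≤ η ≤ 1/2` the update factor `1 - ηx` is positive. [folklore] -/
private theorem one_sub_mul_pos (hη0 : 0 ≤ η) (hη : η ≤ 1 / 2) {x : ℝ} (hx : |x| ≤ 1) :
    0 < 1 - η * x := by
  have h1 : η * x ≤ η * 1 := mul_le_mul_of_nonneg_left ((le_abs_self x).trans hx) hη0
  linarith

omit [Fintype ι] in
/-- The weights stay positive. [cite: AroraHazanKale2012, proof of Theorem 2.1] -/
theorem weight_pos (hη0 : 0 ≤ η) (hη : η ≤ 1 / 2) (hm : ∀ t i, |m t i| ≤ 1) (t : ℕ) (i : ι) :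
    0 < weight η m t i := by
  induction t with
  | zero => simp
  | succ t ih =>
    rw [weight_succ]
    exact mul_pos ih (one_sub_mul_pos hη0 hη (hm t i))

/-- The potential is positive. [cite: AroraHazanKale2012, proof of Theorem 2.1] -/
theorem potential_pos [Nonempty ι] (hη0 : 0 ≤ η) (hη : η ≤ 1 / 2) (hm : ∀ t i, |m t i| ≤ 1)
    (t : ℕ) : 0 < potential η m t :=
  Finset.sum_pos (fun i _ => weight_pos hη0 hη hm t i) Finset.univ_nonempty

/-- `p^{(t)}` is a probability distribution: non-negative … [cite: AroraHazanKale2012, Figure 1] -/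
theorem prob_nonneg [Nonempty ι] (hη0 : 0 ≤ η) (hη : η ≤ 1 / 2) (hm : ∀ t i, |m t i| ≤ 1)
    (t : ℕ) (i : ι) : 0 ≤ prob η m t i :=
  div_nonneg (weight_pos hη0 hη hm t i).le (potential_pos hη0 hη hm t).le

/-- … and summing to `1`. [cite: AroraHazanKale2012, Figure 1] -/
theorem sum_prob [Nonempty ι] (hη0 : 0 ≤ η) (hη : η ≤ 1 / 2) (hm : ∀ t i, |m t i| ≤ 1) (t : ℕ) :
    ∑ i, prob η m t i = 1 := by
  unfold prob
  rw [← Finset.sum_div]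
  exact div_self (potential_pos hη0 hη hm t).ne'

/-- `w_i^{(t)} ≤ Φ^{(t)}`.
[cite: AroraHazanKale2012, proof of Theorem 2.1 (`Φ^{(T+1)} ≥ w_i^{(T+1)}`)] -/
theorem weight_le_potential (hη0 : 0 ≤ η) (hη : η ≤ 1 / 2) (hm : ∀ t i, |m t i| ≤ 1) (t : ℕ)
    (i : ι) : weight η m t i ≤ potential η m t :=
  Finset.single_le_sum (f := fun j => weight η m t j) (fun j _ => (weight_pos hη0 hη hm t j).le)
    (Finset.mem_univ i)

/-- `Φ^{(t)} · (m^{(t)} · p^{(t)}) = Σ_i m_i^{(t)} w_i^{(t)}` ("we used the fact that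
`p_i^{(t)} = w_i^{(t)} / Φ^{(t)}`"). [cite: AroraHazanKale2012, proof of Theorem 2.1] -/
theorem potential_mul_expCost [Nonempty ι] (hη0 : 0 ≤ η) (hη : η ≤ 1 / 2)
    (hm : ∀ t i, |m t i| ≤ 1) (t : ℕ) :
    potential η m t * expCost η m t = ∑ i, m t i * weight η m t i := by
  have hΦ := (potential_pos hη0 hη hm t).ne'
  unfold expCost prob
  rw [Finset.mul_sum]
  refine Finset.sum_congr rfl fun i _ => ?_
  field_simp

/-- **`Φ^{(t+1)} = Φ^{(t)} (1 - η m^{(t)} · p^{(t)})`**.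
[cite: AroraHazanKale2012, proof of Theorem 2.1 (first display)] -/
theorem potential_succ [Nonempty ι] (hη0 : 0 ≤ η) (hη : η ≤ 1 / 2) (hm : ∀ t i, |m t i| ≤ 1)
    (t : ℕ) : potential η m (t + 1) = potential η m t * (1 - η * expCost η m t) := by
  rw [mul_sub, mul_one, mul_left_comm, potential_mul_expCost hη0 hη hm t, Finset.mul_sum]
  simp only [potential, weight_succ]
  rw [← Finset.sum_sub_distrib]
  exact Finset.sum_congr rfl fun i _ => by ring

/-- **`Φ^{(t+1)} ≤ Φ^{(t)} exp(-η m^{(t)} · p^{(t)})`** (by `1 - x ≤ e^{-x}`).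
[cite: AroraHazanKale2012, proof of Theorem 2.1 (first display)] -/
theorem potential_succ_le [Nonempty ι] (hη0 : 0 ≤ η) (hη : η ≤ 1 / 2) (hm : ∀ t i, |m t i| ≤ 1)
    (t : ℕ) : potential η m (t + 1) ≤ potential η m t * exp (-(η * expCost η m t)) := by
  rw [potential_succ hη0 hη hm t]
  refine mul_le_mul_of_nonneg_left ?_ (potential_pos hη0 hη hm t).le
  have := add_one_le_exp (-(η * expCost η m t))
  linarith

/-- **Eq. (2.2)**:
`Φ^{(T+1)} ≤ Φ^{(1)} exp(-η Σ_t m^{(t)}·p^{(t)}) = n · exp(-η Σ_t m^{(t)}·p^{(t)})`.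
[cite: AroraHazanKale2012, eq. (2.2)] -/
theorem potential_le [Nonempty ι] (hη0 : 0 ≤ η) (hη : η ≤ 1 / 2) (hm : ∀ t i, |m t i| ≤ 1)
    (T : ℕ) :
    potential η m T ≤ Fintype.card ι * exp (-(η * ∑ t ∈ range T, expCost η m t)) := by
  induction T with
  | zero => simp [potential_zero]
  | succ T ih =>
    calc potential η m (T + 1)
        ≤ potential η m T * exp (-(η * expCost η m T)) := potential_succ_le hη0 hη hm T
      _ ≤ Fintype.card ι * exp (-(η * ∑ t ∈ range T, expCost η m t)) *
            exp (-(η * expCost η m T)) :=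
          mul_le_mul_of_nonneg_right ih (exp_pos _).le
      _ = Fintype.card ι * exp (-(η * ∑ t ∈ range (T + 1), expCost η m t)) := by
          rw [Finset.sum_range_succ, mul_add, neg_add, Real.exp_add, mul_assoc]

/-- **Eq. (2.3)** (Bernoulli, "from the convexity of the exponential function"):
`(1-η)^x ≤ 1 - ηx` for `x ∈ [0,1]` and `(1+η)^{-x} ≤ 1 - ηx` for `x ∈ [-1,0]`, stated at once as
`(1-η)^{x⁺} (1+η)^{x⁻} ≤ 1 - ηx` for `|x| ≤ 1` (one of the two factors is `1`).
[cite: AroraHazanKale2012, eq. (2.3)] -/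
theorem rpow_posPart_mul_rpow_negPart_le (hη0 : 0 ≤ η) (hη1 : η ≤ 1) {x : ℝ} (hx : |x| ≤ 1) :
    (1 - η) ^ x⁺ * (1 + η) ^ x⁻ ≤ 1 - η * x := by
  rcases le_total 0 x with h | h
  · rw [posPart_eq_self.2 h, negPart_eq_zero.2 h, Real.rpow_zero, mul_one,
      show (1 : ℝ) - η = 1 + -η by ring]
    calc (1 + -η) ^ x ≤ 1 + x * -η :=
          rpow_one_add_le_one_add_mul_self (by linarith) h ((le_abs_self x).trans hx)
      _ = 1 - η * x := by ring
  · rw [posPart_eq_zero.2 h, negPart_eq_neg.2 h, Real.rpow_zero, one_mul]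
    calc (1 + η) ^ (-x) ≤ 1 + -x * η :=
          rpow_one_add_le_one_add_mul_self (by linarith) (by linarith) ((neg_le_abs x).trans hx)
      _ = 1 - η * x := by ring

omit [Fintype ι] in
/-- **Eq. (2.4)**: `w_i^{(T+1)} = Π_{t ≤ T} (1 - η m_i^{(t)}) ≥ (1-η)^{Σ_{≥0} m_i^{(t)}} ·
(1+η)^{-Σ_{<0} m_i^{(t)}}`, with `Σ_{≥0} m_i^{(t)} = Σ_t (m_i^{(t)})⁺` and
`-Σ_{<0} m_i^{(t)} = Σ_t (m_i^{(t)})⁻`. [cite: AroraHazanKale2012, eq. (2.4)] -/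
theorem rpow_le_weight (hη0 : 0 ≤ η) (hη : η ≤ 1 / 2) (hm : ∀ t i, |m t i| ≤ 1) (T : ℕ) (i : ι) :
    (1 - η) ^ (∑ t ∈ range T, (m t i)⁺) * (1 + η) ^ (∑ t ∈ range T, (m t i)⁻) ≤
      weight η m T i := by
  have ha : 0 < 1 - η := by linarith
  have hb : 0 < 1 + η := by linarith
  induction T with
  | zero => simp
  | succ T ih =>
    rw [Finset.sum_range_succ, Finset.sum_range_succ, Real.rpow_add ha, Real.rpow_add hb,
      weight_succ]
    calc (1 - η) ^ (∑ t ∈ range T, (m t i)⁺) * (1 - η) ^ (m T i)⁺ *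
          ((1 + η) ^ (∑ t ∈ range T, (m t i)⁻) * (1 + η) ^ (m T i)⁻)
        = (1 - η) ^ (∑ t ∈ range T, (m t i)⁺) * (1 + η) ^ (∑ t ∈ range T, (m t i)⁻) *
            ((1 - η) ^ (m T i)⁺ * (1 + η) ^ (m T i)⁻) := by ring
      _ ≤ weight η m T i * (1 - η * m T i) :=
          mul_le_mul ih (rpow_posPart_mul_rpow_negPart_le hη0 (by linarith) (hm T i))
            (mul_nonneg (Real.rpow_nonneg ha.le _) (Real.rpow_nonneg hb.le _))
            (weight_pos hη0 hη hm T i).le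

/-- **Eq. (2.5)**, first half: `ln(1/(1-η)) ≤ η + η²` for `0 ≤ η ≤ 1/2` (here from
`e^y ≥ 1 + y + y²/2 + y³/6` at `y = η + η²`). [cite: AroraHazanKale2012, eq. (2.5)] -/
theorem neg_log_one_sub_le (hη0 : 0 ≤ η) (hη : η ≤ 1 / 2) : -Real.log (1 - η) ≤ η + η ^ 2 := by
  rw [neg_le, Real.le_log_iff_exp_le (by linarith)]
  set y := η + η ^ 2 with hy
  have hy0 : 0 ≤ y := by positivity
  have hS : 1 + y + y ^ 2 / 2 + y ^ 3 / 6 ≤ exp y := by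
    have h := Real.sum_le_exp_of_nonneg hy0 4
    simp only [Finset.sum_range_succ, Finset.sum_range_zero, Nat.factorial, pow_zero,
      Nat.cast_one, div_one, zero_add, pow_one] at h
    norm_num [Nat.factorial] at h
    linarith
  have hpos : 0 < 1 + y + y ^ 2 / 2 + y ^ 3 / 6 := by positivity
  have hQ : 0 ≤ 1 / 2 - η / 3 - η ^ 2 / 6 - η ^ 3 / 2 - η ^ 4 / 3 - η ^ 5 / 6 := by
    have h2 : η ^ 2 ≤ 1 / 4 := by nlinarith
    have h3 : η ^ 3 ≤ 1 / 8 := by nlinarith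
    have h4 : η ^ 4 ≤ 1 / 16 := by nlinarith
    have h5 : η ^ 5 ≤ 1 / 32 := by nlinarith
    linarith
  have key : 1 ≤ (1 + y + y ^ 2 / 2 + y ^ 3 / 6) * (1 - η) := by
    have e : (1 + y + y ^ 2 / 2 + y ^ 3 / 6) * (1 - η) - 1 =
        η ^ 2 * (1 / 2 - η / 3 - η ^ 2 / 6 - η ^ 3 / 2 - η ^ 4 / 3 - η ^ 5 / 6) := by
      rw [hy]; ring
    nlinarith [mul_nonneg (sq_nonneg η) hQ]
  rw [Real.exp_neg]
  calc (exp y)⁻¹ ≤ (1 + y + y ^ 2 / 2 + y ^ 3 / 6)⁻¹ := inv_anti₀ hpos hS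
    _ = (1 + y + y ^ 2 / 2 + y ^ 3 / 6)⁻¹ * 1 := (mul_one _).symm
    _ ≤ (1 + y + y ^ 2 / 2 + y ^ 3 / 6)⁻¹ * ((1 + y + y ^ 2 / 2 + y ^ 3 / 6) * (1 - η)) :=
        mul_le_mul_of_nonneg_left key (inv_nonneg.2 hpos.le)
    _ = 1 - η := by field_simp

/-- **Eq. (2.5)**, second half: `ln(1+η) ≥ η - η²` for `η ≥ 0` (from `ln x ≥ 1 - 1/x`).
[cite: AroraHazanKale2012, eq. (2.5)] -/
theorem sub_sq_le_log_one_add (hη0 : 0 ≤ η) : η - η ^ 2 ≤ Real.log (1 + η) := by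
  have h := Real.one_sub_inv_le_log_of_pos (by linarith : (0 : ℝ) < 1 + η)
  have h2 : η - η ^ 2 ≤ 1 - (1 + η)⁻¹ := by
    rw [show (1 : ℝ) - (1 + η)⁻¹ = η / (1 + η) by field_simp; ring, le_div_iff₀ (by linarith)]
    nlinarith [pow_nonneg hη0 3]
  exact h2.trans h

/-- **Theorem 2.1 (Arora–Hazan–Kale): the regret bound of the Multiplicative Weights algorithm.**
With costs in `[-1,1]` and `0 < η ≤ 1/2`, after `T` rounds, for every decision `i`,
`Σ_t m^{(t)}·p^{(t)} ≤ Σ_t m_i^{(t)} + η Σ_t |m_i^{(t)}| + (ln n)/η`.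
[cite: AroraHazanKale2012, Theorem 2.1] -/
theorem regret_le [Nonempty ι] (hη0 : 0 < η) (hη : η ≤ 1 / 2) (hm : ∀ t i, |m t i| ≤ 1) (T : ℕ)
    (i : ι) :
    ∑ t ∈ range T, expCost η m t ≤
      ∑ t ∈ range T, m t i + η * ∑ t ∈ range T, |m t i| + Real.log (Fintype.card ι) / η := by
  set C := ∑ t ∈ range T, expCost η m t
  set P := ∑ t ∈ range T, (m t i)⁺ with hP
  set N := ∑ t ∈ range T, (m t i)⁻ with hN
  have hP0 : 0 ≤ P := Finset.sum_nonneg fun t _ => posPart_nonneg _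
  have hN0 : 0 ≤ N := Finset.sum_nonneg fun t _ => negPart_nonneg _
  have hM : ∑ t ∈ range T, m t i = P - N := by
    rw [hP, hN, ← Finset.sum_sub_distrib]
    exact Finset.sum_congr rfl fun t _ => (posPart_sub_negPart _).symm
  have hA : ∑ t ∈ range T, |m t i| = P + N := by
    rw [hP, hN, ← Finset.sum_add_distrib]
    exact Finset.sum_congr rfl fun t _ => (posPart_add_negPart _).symm
  have ha : 0 < 1 - η := by linarith
  have hb : 0 < 1 + η := by linarith
  have hn : (0 : ℝ) < Fintype.card ι := Nat.cast_pos.2 Fintype.card_pos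
  -- (2.4) ≤ w_i ≤ Φ ≤ (2.2)
  have h1 : (1 - η) ^ P * (1 + η) ^ N ≤ Fintype.card ι * exp (-(η * C)) :=
    (rpow_le_weight hη0.le hη hm T i).trans
      ((weight_le_potential hη0.le hη hm T i).trans (potential_le hη0.le hη hm T))
  -- "Taking logarithms in equations (2.2) and (2.4)"
  have h2 := Real.log_le_log (mul_pos (Real.rpow_pos_of_pos ha _) (Real.rpow_pos_of_pos hb _)) h1
  rw [Real.log_mul (Real.rpow_pos_of_pos ha _).ne' (Real.rpow_pos_of_pos hb _).ne',
    Real.log_rpow ha, Real.log_rpow hb, Real.log_mul hn.ne' (exp_pos _).ne', Real.log_exp] at h2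
  -- "Negating, rearranging, and scaling by 1/η", with (2.5)
  have h3 := mul_le_mul_of_nonneg_left (neg_log_one_sub_le hη0.le hη) hP0
  have h4 := mul_le_mul_of_nonneg_left (sub_sq_le_log_one_add hη0.le) hN0
  have h5 : η * C ≤ Real.log (Fintype.card ι) + η * (P - N) + η ^ 2 * (P + N) := by
    nlinarith
  rw [hM, hA]
  have h6 : C ≤ (Real.log (Fintype.card ι) + η * (P - N) + η ^ 2 * (P + N)) / η := by
    rw [le_div_iff₀ hη0]
    linarith
  calc C ≤ _ := h6
    _ = P - N + η * (P + N) + Real.log (Fintype.card ι) / η := by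
        field_simp
        ring

/-- **Corollary 2.2 (Arora–Hazan–Kale)**: for every distribution `p` on the decisions,
`Σ_t m^{(t)}·p^{(t)} ≤ Σ_t (m^{(t)} + η |m^{(t)}|)·p + (ln n)/η` ("by taking a convex combination of
the inequalities for all decisions `i` with the distribution `p`").
[cite: AroraHazanKale2012, Corollary 2.2] -/
theorem regret_le_of_distribution [Nonempty ι] (hη0 : 0 < η) (hη : η ≤ 1 / 2)
    (hm : ∀ t i, |m t i| ≤ 1) (T : ℕ) (p : ι → ℝ) (hp0 : ∀ i, 0 ≤ p i) (hp1 : ∑ i, p i = 1) :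
    ∑ t ∈ range T, expCost η m t ≤
      ∑ t ∈ range T, ∑ i, (m t i + η * |m t i|) * p i + Real.log (Fintype.card ι) / η := by
  calc ∑ t ∈ range T, expCost η m t
      = ∑ i, p i * ∑ t ∈ range T, expCost η m t := by rw [← Finset.sum_mul, hp1, one_mul]
    _ ≤ ∑ i, p i * (∑ t ∈ range T, m t i + η * ∑ t ∈ range T, |m t i| +
          Real.log (Fintype.card ι) / η) :=
        Finset.sum_le_sum fun i _ => mul_le_mul_of_nonneg_left (regret_le hη0 hη hm T i) (hp0 i)
    _ = ∑ i, p i * ∑ t ∈ range T, (m t i + η * |m t i|) +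
          (∑ i, p i) * (Real.log (Fintype.card ι) / η) := by
        rw [Finset.sum_mul, ← Finset.sum_add_distrib]
        refine Finset.sum_congr rfl fun i _ => ?_
        rw [Finset.sum_add_distrib, Finset.mul_sum (s := range T) (f := fun t => |m t i|)]
        ring
    _ = ∑ t ∈ range T, ∑ i, (m t i + η * |m t i|) * p i + Real.log (Fintype.card ι) / η := by
        rw [hp1, one_mul, Finset.sum_comm]
        congr 1
        refine Finset.sum_congr rfl fun i _ => ?_
        rw [Finset.mul_sum]
        exact Finset.sum_congr rfl fun t _ => by ring

end Analysis

end MultiplicativeWeights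

end Literature.Computability.Learning
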